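import Mathlib
import Summits.MatrixMultiplication.MatrixMultiplication.Theses.CondensationDistance
import Summits.MatrixMultiplication.MatrixMultiplication.Theorems.CondensationDistanceCondensationSound
import Summits.MatrixMultiplication.MatrixMultiplication.Theorems.ShortCondensation.Negative.LevelCoverage
import Summits.MatrixMultiplication.MatrixMultiplication.Theorems.CondensationDistanceShortCondensationStubDodgsonExists

/-!
# Crux `ShortCondensation` (stmt-MatrixMultiplication-15936) — the waist cut: `¬ ShortCondensation` modulo a
static generating-waist bound (negative direction)

Route `MatrixMultiplication/CondensationDistance`.  The crux `ShortCondensation` asserts valid octahedral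
Plücker derivations of `det X` of length `≤ n^(2+ε)` inside `J(n + m', n)`, `n ≤ m' ≤ n^c`.  This file
converts the DYNAMIC statement into a STATIC one about the raw-minor coordinates
`P J = det ([1 | Z] ∘ sorted J)` of the generic `n × m'` matrix `Z = [X | Y]` (the coordinate system of
the landed soundness crux `CondensationSound_of`), and lands the kill chain as a kernel-checked implication.

* `waistCut_mem` (**the cut lemma**, unconditional): in a valid listing, for every `k ≥ 2`, the coordinate of
  every listed set of level `≥ k + 2` (level `= #{x ∈ J | n ≤ x}` = size of the minor of `Z`) lies in every
  subfield of `ℂ(Z)` containing `ℂ` and the coordinates of the listed sets of level exactly `k` or `k + 1`.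
  (The five octahedron mates of a level-`h` set have level `≥ h - 2 ≥ k ≥ 2`, so none is in the ball: all are
  listed earlier; the exchange relation `P J · P J₅ = ε₁ P J₁ P J₄ + ε₂ P J₂ P J₃` with `P J₅ ≠ 0`
  (`exchange_of_stubs`, `nonvanishing_of_stubs`) expresses `P J` rationally; well-founded descent.)
* `waistCut_detX_mem`: hence `det X` itself (the target `{n ≤ x < 2n}`, level `n`, `target_of_stubs`) is a
  rational function over `ℂ` of the listed level-`{k, k+1}` coordinates, for every `2 ≤ k ≤ n - 2`.
* `StaticWaistBound` (hypothesis `H`, a precise static statement, OPEN): a family `W` of column sets that is a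
  rational generating waist for `det X` at EVERY level pair `{k, k+1}`, `2 ≤ k ≤ n - 2`, has `≥ n^(2+δ)` members
  for some fixed `δ > 0`, all large `n` and all `n ≤ m' ≤ n^c`.  (Implied by the strategists' `WaistRigidity`
  `α_k(n, m') ≥ c·n²` for `k ≤ n/2`; exact data `α₁(3) = α₂(4) = α₃(5) = 5`, `α₁(4) = 10`, all `= (n-k)²+1`.)
* `ShortCondensation_false_of_StaticWaistBound` (**the kill chain**): `StaticWaistBound → ¬ ShortCondensation`
  (take `ε := δ/2`; the listed family is a waist tower by the cut lemma, so `n^(2+δ) ≤ l ≤ n^(2+δ/2)`, absurd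
  for `n ≥ 2`).
* `staticWaistBound_premise_of_listing` / `staticWaistBound_premise_dodgson`: the premise of `H` is what every
  valid listing provides, and Dodgson condensation (`stub_dodgsonExists`) inhabits it with `#W ≤ n³`.
* `staticWaistBound_of_levelBound`: the PER-LEVEL bound (`≥ n^(1+δ)` members of level `k` or `k+1` whenever
  `det X` is rational over them, for `n/4 ≤ k ≤ n/2`) implies `H` with exponent `2 + δ/2` (disjoint level pairs).

No refutation is claimed: `H` is not proved here (known: `≥ c·n²` by coverage at `k = 2`; conjectured
`(n-k)²+1` per level pair).  [folklore]
-/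

set_option linter.dupNamespace false

namespace Summit.MatrixMultiplication.MatrixMultiplication.Theorems.ShortCondensation

open Summit.MatrixMultiplication.MatrixMultiplication.Theses.CondensationDistance (ShortCondensation)
open Summit.MatrixMultiplication.MatrixMultiplication.Theorems.CondensationSound
  (exchange_of_stubs nonvanishing_of_stubs target_of_stubs)

/-- The raw-minor Plücker coordinate of a column set `J ⊆ Fin (n + m')`: the maximal minor of `[1 | Z]` on the
sorted enumeration of `J`, pushed into `ℂ(Z)`; junk `0` when `#J ≠ n`.  (The coordinate system of
`CondensationSound_of`.) -/
noncomputable def waistCoord (n m' : ℕ) (J : Finset (Fin (n + m'))) :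
    FractionRing (MvPolynomial (Fin n × Fin m') ℂ) :=
  if hJ : J.card = n then
    algebraMap (MvPolynomial (Fin n × Fin m') ℂ) (FractionRing (MvPolynomial (Fin n × Fin m') ℂ))
      (((Matrix.fromCols (1 : Matrix (Fin n) (Fin n) (MvPolynomial (Fin n × Fin m') ℂ))
        (Matrix.of fun i j => MvPolynomial.X (i, j))).submatrix id ⇑finSumFinEquiv.symm).submatrix
          id ⇑(J.orderEmbOfFin hJ)).det
  else 0

/-- On an `n`-set the coordinate is the maximal minor of `[1 | Z]` on its sorted enumeration. [folklore] -/
theorem waistCoord_eq (n m' : ℕ) (J : Finset (Fin (n + m'))) (hJ : J.card = n) :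
    waistCoord n m' J =
      algebraMap (MvPolynomial (Fin n × Fin m') ℂ) (FractionRing (MvPolynomial (Fin n × Fin m') ℂ))
        (((Matrix.fromCols (1 : Matrix (Fin n) (Fin n) (MvPolynomial (Fin n × Fin m') ℂ))
          (Matrix.of fun i j => MvPolynomial.X (i, j))).submatrix id ⇑finSumFinEquiv.symm).submatrix
            id ⇑(J.orderEmbOfFin hJ)).det :=
  dif_pos hJ

/-- The level-pair field of a family `W` of column sets: the subfield of `ℂ(Z)` generated over `ℂ` by the
raw-minor coordinates of the members of `W` of level exactly `k` or `k + 1`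
(level `= #{x ∈ J | n ≤ x}` = the size of the corresponding minor of `Z`). -/
noncomputable def waistField (n m' : ℕ) (W : Finset (Finset (Fin (n + m')))) (k : ℕ) :
    Subfield (FractionRing (MvPolynomial (Fin n × Fin m') ℂ)) :=
  Subfield.closure
    (Set.range (algebraMap ℂ (FractionRing (MvPolynomial (Fin n × Fin m') ℂ))) ∪
      waistCoord n m' '' {J | J ∈ W ∧
        ((J.filter fun x : Fin (n + m') => n ≤ x.val).card = k ∨
          (J.filter fun x : Fin (n + m') => n ≤ x.val).card = k + 1)})

/-- **Hypothesis `H` (static generating-waist bound; OPEN).**  For some fixed `δ > 0`: for every `c`, all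
large `n`, every `n ≤ m' ≤ n ^ c` and every family `W` of `n`-subsets of `Fin (n + m')` of levels `≥ 2` that is
a RATIONAL WAIST TOWER for `det X` — for EVERY `k` with `2 ≤ k ≤ n - 2`, the determinant `det X` (`X` = the
first `n` columns of the generic `n × m'` matrix `Z`) and the coordinate of every member of level `≥ k + 2` are
rational functions over `ℂ` of the coordinates of the members of level `k` or `k + 1` — one has
`#W ≥ n ^ (2 + δ)`.  Every valid octahedral listing of `det X` yields such a tower of size `≤` its length
(`waistCut_mem`), and Dodgson condensation one of size `≤ n³` (`staticWaistBound_premise_of_listing` with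
`stub_dodgsonExists`); the strategists' `WaistRigidity` (`α_k(n, m') ≥ c·n²` for `2 ≤ k ≤ n/2`; exact data
`α₁(3) = α₂(4) = α₃(5) = 5`, `α₁(4) = 10`, all `= (n-k)²+1` = Sylvester) implies it with any `δ < 1`.
[topic: Computability/AlgebraicComplexity — generating sets of minors for the generic determinant] -/
def StaticWaistBound : Prop :=
  ∃ δ : ℝ, 0 < δ ∧ ∀ c : ℕ, ∃ n₁ : ℕ, ∀ n ≥ n₁, ∀ (m' : ℕ) (h : n ≤ m'), m' ≤ n ^ c →
    ∀ W : Finset (Finset (Fin (n + m'))),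
      (∀ J ∈ W, J.card = n ∧ 2 ≤ (J.filter fun x : Fin (n + m') => n ≤ x.val).card) →
      (∀ k : ℕ, 2 ≤ k → k + 2 ≤ n →
        algebraMap (MvPolynomial (Fin n × Fin m') ℂ) (FractionRing (MvPolynomial (Fin n × Fin m') ℂ))
            (Matrix.det (Matrix.of fun i j : Fin n => MvPolynomial.X (i, Fin.castLE h j))) ∈
          waistField n m' W k ∧
        ∀ J ∈ W, k + 2 ≤ (J.filter fun x : Fin (n + m') => n ≤ x.val).card →
          waistCoord n m' J ∈ waistField n m' W k) →
      (n : ℝ) ^ (2 + δ) ≤ (W.card : ℝ)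

/-- **Per-level form `H'` implies `H`** (closer to the strategists' `WaistRigidity`).  Suppose that for a fixed
`δ > 0`: for every `c`, all large `n`, every `n ≤ m' ≤ n ^ c`, every level `k` in the window `n/4 ≤ k ≤ n/2` and
every family `W` over whose level-`{k, k+1}` raw-minor coordinates `det X` is rational, `W` has at least
`n ^ (1 + δ)` members of level `k` or `k + 1` (`WaistRigidity` claims `c·n²`; Sylvester frames give `(n-k)²+1`).
Then `StaticWaistBound` holds with exponent `2 + δ/2`: the level pairs `{2j, 2j+1}`, `(n+7)/8 ≤ j ≤ n/4`, are
pairwise disjoint, there are `≥ n/16` of them once `n ≥ 32`, each carries `≥ n^(1+δ)` members of `W`, and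
`16 · n^(2+δ/2) ≤ n^(δ/2) · n^(2+δ/2) = n · n^(1+δ)` once `n^(δ/2) ≥ 16`. [folklore] -/
theorem staticWaistBound_of_levelBound (δ : ℝ) (hδ : 0 < δ)
    (hH : ∀ c : ℕ, ∃ n₁ : ℕ, ∀ n ≥ n₁, ∀ (m' : ℕ) (h : n ≤ m'), m' ≤ n ^ c →
      ∀ k : ℕ, n ≤ 4 * k → 2 * k ≤ n →
      ∀ W : Finset (Finset (Fin (n + m'))),
        algebraMap (MvPolynomial (Fin n × Fin m') ℂ) (FractionRing (MvPolynomial (Fin n × Fin m') ℂ))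
            (Matrix.det (Matrix.of fun i j : Fin n => MvPolynomial.X (i, Fin.castLE h j))) ∈
          waistField n m' W k →
        (n : ℝ) ^ (1 + δ) ≤
          ((W.filter fun J => (J.filter fun x : Fin (n + m') => n ≤ x.val).card = k ∨
            (J.filter fun x : Fin (n + m') => n ≤ x.val).card = k + 1).card : ℝ)) :
    StaticWaistBound := by
  classical
  refine ⟨δ / 2, half_pos hδ, fun c => ?_⟩
  obtain ⟨n₁, hn₁⟩ := hH c
  -- eventually `16 ≤ n ^ (δ/2)`
  obtain ⟨N, hN⟩ : ∃ N : ℕ, ∀ n ≥ N, (16 : ℝ) ≤ (n : ℝ) ^ (δ / 2) := by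
    have ht := ((tendsto_rpow_atTop (half_pos hδ)).comp tendsto_natCast_atTop_atTop).eventually_ge_atTop 16
    obtain ⟨N, hN⟩ := Filter.eventually_atTop.1 ht
    exact ⟨N, fun n hn => hN n hn⟩
  refine ⟨max (max n₁ N) 32, fun n hn m' h hmc W _hWn hWk => ?_⟩
  have hn₁' : n₁ ≤ n := ((le_max_left _ _).trans (le_max_left _ _)).trans hn
  have hN' : N ≤ n := ((le_max_right _ _).trans (le_max_left _ _)).trans hn
  have h32 : 32 ≤ n := (le_max_right _ _).trans hn
  -- the index set of level pairs `{2j, 2j+1}`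
  set S : Finset ℕ := Finset.Ico ((n + 7) / 8) (n / 4 + 1) with hS
  let T : ℕ → Finset (Finset (Fin (n + m'))) := fun j => W.filter fun J =>
    (J.filter fun x : Fin (n + m') => n ≤ x.val).card = 2 * j ∨
      (J.filter fun x : Fin (n + m') => n ≤ x.val).card = 2 * j + 1
  -- each level pair in the window carries `n^(1+δ)` members
  have hT : ∀ j ∈ S, (n : ℝ) ^ (1 + δ) ≤ ((T j).card : ℝ) := by
    intro j hj
    rw [hS, Finset.mem_Ico] at hj
    have h1 : n ≤ 4 * (2 * j) := by omega
    have h2 : 2 * (2 * j) ≤ n := by omega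
    exact hn₁ n hn₁' m' h hmc (2 * j) h1 h2 W (hWk (2 * j) (by omega) (by omega)).1
  -- the level pairs are disjoint, so the members add up inside `W`
  have hdisj : (S : Set ℕ).PairwiseDisjoint T := by
    intro a _ b _ hab
    rw [Function.onFun, Finset.disjoint_left]
    intro J hJa hJb
    simp only [T, Finset.mem_filter] at hJa hJb
    omega
  have hsumW : ∑ j ∈ S, (T j).card ≤ W.card := by
    rw [← Finset.card_biUnion hdisj]
    exact Finset.card_le_card (Finset.biUnion_subset.2 fun j _ => Finset.filter_subset _ _)
  have hsum : (S.card : ℝ) * (n : ℝ) ^ (1 + δ) ≤ (W.card : ℝ) :=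
    calc (S.card : ℝ) * (n : ℝ) ^ (1 + δ) = ∑ j ∈ S, (n : ℝ) ^ (1 + δ) := by
          rw [Finset.sum_const, nsmul_eq_mul]
      _ ≤ ∑ j ∈ S, ((T j).card : ℝ) := Finset.sum_le_sum hT
      _ = ((∑ j ∈ S, (T j).card : ℕ) : ℝ) := by push_cast; rfl
      _ ≤ (W.card : ℝ) := by exact_mod_cast hsumW
  -- there are at least `n / 16` level pairs in the window
  have hScard : n ≤ 16 * S.card := by
    rw [hS, Nat.card_Ico]
    omega
  -- arithmetic: `16 · n^(2+δ/2) ≤ n^(δ/2) · n^(2+δ/2) = n^(2+δ) = n · n^(1+δ) ≤ 16 · #S · n^(1+δ) ≤ 16 · #W`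
  have hn0 : (0 : ℝ) < n := by exact_mod_cast (show 0 < n by omega)
  have e1 : (n : ℝ) ^ (2 + δ / 2) * (n : ℝ) ^ (δ / 2) = (n : ℝ) * (n : ℝ) ^ (1 + δ) := by
    rw [← Real.rpow_add hn0, show 2 + δ / 2 + δ / 2 = 1 + (1 + δ) by ring, Real.rpow_add hn0, Real.rpow_one]
  have hpos : (0 : ℝ) ≤ (n : ℝ) ^ (2 + δ / 2) := Real.rpow_nonneg hn0.le _
  have hpos' : (0 : ℝ) ≤ (n : ℝ) ^ (1 + δ) := Real.rpow_nonneg hn0.le _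
  have hSR : (n : ℝ) ≤ 16 * (S.card : ℝ) := by exact_mod_cast hScard
  nlinarith [mul_le_mul_of_nonneg_left (hN n hN') hpos, mul_le_mul_of_nonneg_right hSR hpos']

/-- A double exchange `J ↦ insert u (insert v ((J.erase p).erase q))` lowers the number of elements
satisfying a predicate by at most two. [folklore] -/
theorem waistCut_filter_card_le_double {α : Type*} [DecidableEq α] (P : α → Prop) [DecidablePred P]
    (J : Finset α) (p q u v : α) :
    (J.filter P).card ≤ ((insert u (insert v ((J.erase p).erase q))).filter P).card + 2 := by
  calc (J.filter P).card
      ≤ (insert p (insert q ((insert u (insert v ((J.erase p).erase q))).filter P))).card := by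
        apply Finset.card_le_card
        intro z hz
        simp only [Finset.mem_filter] at hz
        simp only [Finset.mem_insert, Finset.mem_filter, Finset.mem_erase]
        by_cases hzp : z = p
        · exact Or.inl hzp
        · by_cases hzq : z = q
          · exact Or.inr (Or.inl hzq)
          · exact Or.inr (Or.inr ⟨Or.inr (Or.inr ⟨hzq, hzp, hz.1⟩), hz.2⟩)
    _ ≤ (insert q ((insert u (insert v ((J.erase p).erase q))).filter P)).card + 1 :=
        Finset.card_insert_le _ _
    _ ≤ ((insert u (insert v ((J.erase p).erase q))).filter P).card + 1 + 1 :=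
        Nat.add_le_add_right (Finset.card_insert_le _ _) 1

/-- **The cut lemma.**  In a valid octahedral listing `f` of column sets of `Fin (n + m')` (the route's
validity predicate verbatim), let `k ≥ 2` and let `F` be a subfield of `ℂ(Z)` containing the constants and the
raw-minor coordinate of every listed set of level exactly `k` or `k + 1`.  Then `F` contains the coordinate of
every listed set of level `≥ k + 2`.  Proof: descent on the position `i`; the five mates of `f i` have level
`≥ level (f i) - 2 ≥ k ≥ 2`, so they are not in the ball, hence listed earlier, hence (induction, or generators)
in `F`; and `P (f i) = (ε₁ P J₁ P J₄ + ε₂ P J₂ P J₃) / P J₅` with `P J₅ ≠ 0`. [folklore] -/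
theorem waistCut_mem {n m' l : ℕ} {f : Fin l → Finset (Fin (n + m'))}
    (hvalid : ∀ i : Fin l, ∃ p ∈ f i, ∃ q ∈ f i, p ≠ q ∧ ∃ u ∉ f i, ∃ v ∉ f i, u ≠ v ∧
      ∀ J ∈ [insert u ((f i).erase p), insert v ((f i).erase p), insert u ((f i).erase q),
        insert v ((f i).erase q), insert u (insert v (((f i).erase p).erase q))],
        (J.card = n ∧ (J.filter fun x : Fin (n + m') => n ≤ x.val).card ≤ 1) ∨
          ∃ j : Fin l, j < i ∧ f j = J)
    {k : ℕ} (hk : 2 ≤ k) (F : Subfield (FractionRing (MvPolynomial (Fin n × Fin m') ℂ)))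
    (hC : ∀ z : ℂ, algebraMap ℂ (FractionRing (MvPolynomial (Fin n × Fin m') ℂ)) z ∈ F)
    (hgen : ∀ j : Fin l,
      (((f j).filter fun x : Fin (n + m') => n ≤ x.val).card = k ∨
        ((f j).filter fun x : Fin (n + m') => n ≤ x.val).card = k + 1) → waistCoord n m' (f j) ∈ F)
    (i : Fin l) (hi : k + 2 ≤ ((f i).filter fun x : Fin (n + m') => n ≤ x.val).card) :
    waistCoord n m' (f i) ∈ F := by
  classical
  suffices H : ∀ t : ℕ, ∀ i : Fin l, i.val < t →
      k + 2 ≤ ((f i).filter fun x : Fin (n + m') => n ≤ x.val).card → waistCoord n m' (f i) ∈ F from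
    H _ i (Nat.lt_succ_self _) hi
  intro t
  induction t with
  | zero => intro i hi; exact absurd hi (Nat.not_lt_zero _)
  | succ t ih =>
    intro i hit hi
    obtain ⟨p, hp, q, hq, hpq, u, hu, v, hv, huv, hall⟩ := hvalid i
    -- a mate of level `≥ level (f i) - 2` is listed earlier, has `n` elements and its coordinate is in `F`
    have mate : ∀ M : Finset (Fin (n + m')),
        ((f i).filter fun x : Fin (n + m') => n ≤ x.val).card ≤
            (M.filter fun x : Fin (n + m') => n ≤ x.val).card + 2 →
        ((M.card = n ∧ (M.filter fun x : Fin (n + m') => n ≤ x.val).card ≤ 1) ∨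
            ∃ j : Fin l, j < i ∧ f j = M) →
        M.card = n ∧ waistCoord n m' M ∈ F := by
      intro M hM hdisj
      rcases hdisj with ⟨-, hball⟩ | ⟨j, hj, hfj⟩
      · exfalso
        omega
      · subst hfj
        refine ⟨levelCoverage_card hvalid j, ?_⟩
        by_cases hbig : k + 2 ≤ ((f j).filter fun x : Fin (n + m') => n ≤ x.val).card
        · exact ih j (by rw [Fin.lt_def] at hj; omega) hbig
        · exact hgen j (by omega)
    have hl₁ := levelCoverage_filter_card_le_exchange (fun z : Fin (n + m') => n ≤ z.val) (f i) p u
    have hl₂ := levelCoverage_filter_card_le_exchange (fun z : Fin (n + m') => n ≤ z.val) (f i) p v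
    have hl₃ := levelCoverage_filter_card_le_exchange (fun z : Fin (n + m') => n ≤ z.val) (f i) q u
    have hl₄ := levelCoverage_filter_card_le_exchange (fun z : Fin (n + m') => n ≤ z.val) (f i) q v
    have hl₅ := waistCut_filter_card_le_double (fun z : Fin (n + m') => n ≤ z.val) (f i) p q u v
    obtain ⟨-, hm₁⟩ := mate (insert u ((f i).erase p)) (by omega) (hall _ (by simp))
    obtain ⟨-, hm₂⟩ := mate (insert v ((f i).erase p)) (by omega) (hall _ (by simp))
    obtain ⟨-, hm₃⟩ := mate (insert u ((f i).erase q)) (by omega) (hall _ (by simp))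
    obtain ⟨-, hm₄⟩ := mate (insert v ((f i).erase q)) (by omega) (hall _ (by simp))
    obtain ⟨hc₅, hm₅⟩ := mate (insert u (insert v (((f i).erase p).erase q))) (by omega) (hall _ (by simp))
    -- the exchange relation, solved for `P (f i)`
    have hcard : (f i).card = n := levelCoverage_card hvalid i
    obtain ⟨ε₁, ε₂, hrel⟩ := exchange_of_stubs n m' (waistCoord n m') (waistCoord_eq n m')
      (f i) p q u v hcard hp hq hpq hu hv huv
    have h5 : waistCoord n m' (insert u (insert v (((f i).erase p).erase q))) ≠ 0 :=
      nonvanishing_of_stubs n m' (waistCoord n m') (waistCoord_eq n m') _ hc₅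
    have hsol : waistCoord n m' (f i) =
        (ε₁ • (waistCoord n m' (insert u ((f i).erase p)) * waistCoord n m' (insert v ((f i).erase q))) +
          ε₂ • (waistCoord n m' (insert v ((f i).erase p)) * waistCoord n m' (insert u ((f i).erase q)))) *
        (waistCoord n m' (insert u (insert v (((f i).erase p).erase q))))⁻¹ := by
      rw [← hrel, mul_inv_cancel_right₀ h5]
    rw [hsol]
    simp only [Algebra.smul_def]
    exact mul_mem (add_mem (mul_mem (hC ε₁) (mul_mem hm₁ hm₄)) (mul_mem (hC ε₂) (mul_mem hm₂ hm₃)))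
      (inv_mem hm₅)

/-- **`det X` is rational in every level pair.**  In a valid listing that lists the target `{n ≤ x < 2n}`
(`n ≤ m'`), for every `2 ≤ k ≤ n - 2` the determinant `det X` lies in every subfield of `ℂ(Z)` containing `ℂ`
and the raw-minor coordinates of the listed sets of level `k` or `k + 1` (the target has level `n ≥ k + 2` and
coordinate `+det X`, `target_of_stubs`). [folklore] -/
theorem waistCut_detX_mem {n m' l : ℕ} (hnm : n ≤ m') {f : Fin l → Finset (Fin (n + m'))}
    (hvalid : ∀ i : Fin l, ∃ p ∈ f i, ∃ q ∈ f i, p ≠ q ∧ ∃ u ∉ f i, ∃ v ∉ f i, u ≠ v ∧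
      ∀ J ∈ [insert u ((f i).erase p), insert v ((f i).erase p), insert u ((f i).erase q),
        insert v ((f i).erase q), insert u (insert v (((f i).erase p).erase q))],
        (J.card = n ∧ (J.filter fun x : Fin (n + m') => n ≤ x.val).card ≤ 1) ∨
          ∃ j : Fin l, j < i ∧ f j = J)
    (htarget : ∃ i : Fin l, f i = Finset.univ.filter fun x : Fin (n + m') => n ≤ x.val ∧ x.val < 2 * n)
    {k : ℕ} (hk : 2 ≤ k) (hkn : k + 2 ≤ n) (F : Subfield (FractionRing (MvPolynomial (Fin n × Fin m') ℂ)))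
    (hC : ∀ z : ℂ, algebraMap ℂ (FractionRing (MvPolynomial (Fin n × Fin m') ℂ)) z ∈ F)
    (hgen : ∀ j : Fin l,
      (((f j).filter fun x : Fin (n + m') => n ≤ x.val).card = k ∨
        ((f j).filter fun x : Fin (n + m') => n ≤ x.val).card = k + 1) → waistCoord n m' (f j) ∈ F) :
    algebraMap (MvPolynomial (Fin n × Fin m') ℂ) (FractionRing (MvPolynomial (Fin n × Fin m') ℂ))
        (Matrix.det (Matrix.of fun i j : Fin n => MvPolynomial.X (i, Fin.castLE hnm j))) ∈ F := by
  classical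
  obtain ⟨i₀, hi₀⟩ := htarget
  have hTfil : ((f i₀).filter fun x : Fin (n + m') => n ≤ x.val) = f i₀ := by
    apply Finset.filter_true_of_mem
    intro x hx
    rw [hi₀, Finset.mem_filter] at hx
    exact hx.2.1
  have hTlev : ((f i₀).filter fun x : Fin (n + m') => n ≤ x.val).card = n := by
    rw [hTfil, levelCoverage_card hvalid i₀]
  have hmem := waistCut_mem hvalid hk F hC hgen i₀ (by rw [hTlev]; omega)
  rwa [hi₀, target_of_stubs n m' (waistCoord n m') (waistCoord_eq n m') hnm] at hmem

/-- **Every valid listing of `det X` yields a rational waist tower of size at most its length**: the listed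
sets of level `≥ 2` satisfy the premise of `StaticWaistBound` (by `waistCut_mem`, `waistCut_detX_mem`,
`levelCoverage_card`). [folklore] -/
theorem staticWaistBound_premise_of_listing {n m' l : ℕ} (hnm : n ≤ m') {f : Fin l → Finset (Fin (n + m'))}
    (hvalid : ∀ i : Fin l, ∃ p ∈ f i, ∃ q ∈ f i, p ≠ q ∧ ∃ u ∉ f i, ∃ v ∉ f i, u ≠ v ∧
      ∀ J ∈ [insert u ((f i).erase p), insert v ((f i).erase p), insert u ((f i).erase q),
        insert v ((f i).erase q), insert u (insert v (((f i).erase p).erase q))],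
        (J.card = n ∧ (J.filter fun x : Fin (n + m') => n ≤ x.val).card ≤ 1) ∨
          ∃ j : Fin l, j < i ∧ f j = J)
    (htarget : ∃ i : Fin l, f i = Finset.univ.filter fun x : Fin (n + m') => n ≤ x.val ∧ x.val < 2 * n) :
    ∃ W : Finset (Finset (Fin (n + m'))), W.card ≤ l ∧
      (∀ J ∈ W, J.card = n ∧ 2 ≤ (J.filter fun x : Fin (n + m') => n ≤ x.val).card) ∧
      (∀ k : ℕ, 2 ≤ k → k + 2 ≤ n →
        algebraMap (MvPolynomial (Fin n × Fin m') ℂ) (FractionRing (MvPolynomial (Fin n × Fin m') ℂ))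
            (Matrix.det (Matrix.of fun i j : Fin n => MvPolynomial.X (i, Fin.castLE hnm j))) ∈
          waistField n m' W k ∧
        ∀ J ∈ W, k + 2 ≤ (J.filter fun x : Fin (n + m') => n ≤ x.val).card →
          waistCoord n m' J ∈ waistField n m' W k) := by
  classical
  refine ⟨(Finset.univ.image f).filter fun J => 2 ≤ (J.filter fun x : Fin (n + m') => n ≤ x.val).card,
    ?_, ?_, ?_⟩
  · calc ((Finset.univ.image f).filter fun J =>
          2 ≤ (J.filter fun x : Fin (n + m') => n ≤ x.val).card).card
        ≤ (Finset.univ.image f).card := Finset.card_filter_le _ _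
      _ ≤ (Finset.univ : Finset (Fin l)).card := Finset.card_image_le
      _ = l := by rw [Finset.card_univ, Fintype.card_fin]
  · intro J hJ
    rw [Finset.mem_filter, Finset.mem_image] at hJ
    obtain ⟨⟨j, -, rfl⟩, h2⟩ := hJ
    exact ⟨levelCoverage_card hvalid j, h2⟩
  · intro k hk hkn
    have hC : ∀ z : ℂ, algebraMap ℂ (FractionRing (MvPolynomial (Fin n × Fin m') ℂ)) z ∈
        waistField n m' ((Finset.univ.image f).filter fun J =>
          2 ≤ (J.filter fun x : Fin (n + m') => n ≤ x.val).card) k :=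
      fun z => Subfield.subset_closure (Or.inl ⟨z, rfl⟩)
    have hgen : ∀ j : Fin l,
        (((f j).filter fun x : Fin (n + m') => n ≤ x.val).card = k ∨
          ((f j).filter fun x : Fin (n + m') => n ≤ x.val).card = k + 1) →
        waistCoord n m' (f j) ∈ waistField n m' ((Finset.univ.image f).filter fun J =>
          2 ≤ (J.filter fun x : Fin (n + m') => n ≤ x.val).card) k := by
      intro j hj
      refine Subfield.subset_closure (Or.inr ⟨f j, ⟨?_, hj⟩, rfl⟩)
      rw [Finset.mem_filter]
      exact ⟨Finset.mem_image_of_mem f (Finset.mem_univ j), by omega⟩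
    refine ⟨waistCut_detX_mem hnm hvalid htarget hk hkn _ hC hgen, ?_⟩
    intro J hJ hlev
    rw [Finset.mem_filter, Finset.mem_image] at hJ
    obtain ⟨⟨j, -, rfl⟩, -⟩ := hJ
    exact waistCut_mem hvalid hk _ hC hgen j hlev

/-- **The premise of `StaticWaistBound` is inhabited, with `#W ≤ n³`** (so `H` is a genuine quantitative
statement, sandwiched between `n^(2+δ)` and Dodgson's `n³`): Dodgson condensation (`stub_dodgsonExists`, no
auxiliary columns, `m' = n`) is a valid listing of `det X` of length `≤ n³`. [folklore] -/
theorem staticWaistBound_premise_dodgson (n : ℕ) (hn : 2 ≤ n) :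
    ∃ W : Finset (Finset (Fin (n + n))), W.card ≤ n ^ 3 ∧
      (∀ J ∈ W, J.card = n ∧ 2 ≤ (J.filter fun x : Fin (n + n) => n ≤ x.val).card) ∧
      (∀ k : ℕ, 2 ≤ k → k + 2 ≤ n →
        algebraMap (MvPolynomial (Fin n × Fin n) ℂ) (FractionRing (MvPolynomial (Fin n × Fin n) ℂ))
            (Matrix.det (Matrix.of fun i j : Fin n => MvPolynomial.X (i, Fin.castLE le_rfl j))) ∈
          waistField n n W k ∧
        ∀ J ∈ W, k + 2 ≤ (J.filter fun x : Fin (n + n) => n ≤ x.val).card →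
          waistCoord n n J ∈ waistField n n W k) := by
  classical
  obtain ⟨l, f, hl, hvalid, i₀, hi₀⟩ := stub_dodgsonExists n hn
  have htarget : ∃ i : Fin l, f i =
      Finset.univ.filter fun x : Fin (n + n) => n ≤ x.val ∧ x.val < 2 * n := by
    refine ⟨i₀, ?_⟩
    rw [hi₀]
    apply Finset.filter_congr
    intro x _
    constructor
    · intro h
      exact ⟨h, by omega⟩
    · exact fun h => h.1
  obtain ⟨W, hWl, hW⟩ := staticWaistBound_premise_of_listing le_rfl hvalid htarget
  exact ⟨W, hWl.trans hl, hW⟩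

/-- **The kill chain: `¬ ShortCondensation` modulo the static waist bound.**  If `StaticWaistBound` holds
with exponent `2 + δ`, run `ShortCondensation` with `ε := δ / 2` at `n := max (max n₀ n₁) 2`: the listed
sets of level `≥ 2` form a rational waist tower `W` with `#W ≤ l` (`staticWaistBound_premise_of_listing`), so
`n^(2+δ) ≤ #W ≤ l ≤ n^(2+δ/2) < n^(2+δ)`. [folklore] -/
theorem ShortCondensation_false_of_StaticWaistBound (H : StaticWaistBound) : ¬ ShortCondensation := by
  intro hX
  obtain ⟨δ, hδ, hH⟩ := H
  obtain ⟨c, n₀, hc⟩ := hX (δ / 2) (half_pos hδ)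
  obtain ⟨n₁, hn₁⟩ := hH c
  set N : ℕ := max (max n₀ n₁) 2 with hN
  have hN₀ : n₀ ≤ N := (le_max_left _ _).trans (le_max_left _ _)
  have hN₁ : n₁ ≤ N := (le_max_right _ _).trans (le_max_left _ _)
  have hN₂ : 2 ≤ N := le_max_right _ _
  obtain ⟨m', hnm, hmc, l, f, hl, hvalid, htarget⟩ := hc N hN₀
  obtain ⟨W, hWl, hWn, hWk⟩ := staticWaistBound_premise_of_listing hnm hvalid htarget
  have key := hn₁ N hN₁ m' hnm hmc W hWn hWk
  have h1 : (W.card : ℝ) ≤ (l : ℝ) := by exact_mod_cast hWl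
  have h2 : (N : ℝ) ^ (2 + δ / 2) < (N : ℝ) ^ (2 + δ) :=
    Real.rpow_lt_rpow_of_exponent_lt (by exact_mod_cast (show 1 < N by omega)) (by linarith)
  linarith

end Summit.MatrixMultiplication.MatrixMultiplication.Theorems.ShortCondensation
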